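import Literature.NumberTheory.Automorphic.Liu2021.Def412AdmissibleIffParity
import Literature.NumberTheory.QuadraticForms.PrescribedNormClassesCM
import Literature.NumberTheory.Automorphic.Liu2021.Def411WeilCarriers
import Literature.NumberTheory.GelbartRogawski1991.UnitaryDualPairThetaKernelCM
import HarnessLib

/-!
# FLOOR-0 P2 — stubs EP `stub_EP_globalEpsIsLine` and E3fin `stub_E3fin_finite` of the E3 sub-line `Cruxes/H413/Lines/F0_P2E3ParityRecut.lean`
# (F0P2-plan (g4) v1 fb1acab9, 2026-08-31T04:12Z; crux item stmt-HodgeConjecture-24833 `HCCMUnconditional.H413`, socket item F0HdictE =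
# stmt-HodgeConjecture-27455): A GLOBAL COLLECTION IS THE CLASS FAMILY OF A LINE, and THE CLASS FAMILY OF A LINE IS TRIVIAL ALMOST EVERYWHERE

Cell hodgecm-mathlib (D-0151), FLOOR 0, programme P2; seat F0P2-p03 (g3) (F0P2-plan (g4) rulings (X3) 03:57:21Z ∕ 04:12:46Z: «p03 ← EP + E3fin, ONE Theorems
file»).  THEOREMS ONLY (no `def`, no instance, no notation, no named fact, no `sorry`); never imports a `Cruxes/…/Lines` module (s347 ∕ s380b): the registered
bodies of `F0P2E3ParityRecut.StubEPGlobalEpsIsLine` (tree v1 :189) and `F0P2E3ParityRecut.StubE3FinFinite` (:199) are RESTATED VERBATIM as the types of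
`stubEP_holds` ∕ `stubE3fin_holds` (script-pasted from the tree bytes).

CONTENT (`L` CM, `L⁺ = maximalRealSubfield L`, `δ = imagUnit L`, `d = imagUnitSq L = δ²`, classes `locF L⁺ d a v ∈ L⁺_vˣ ⧸ N(L_vˣ)` = ★ `Def411WeilCarriers.locF`,
collections ★ `Eps`, ★ `epsOf` in the `(2δ)⁻¹`-normalisation of the pin):
* `locF_ne_one_finite` — RANK-FREE CORE, generic over a number field `F` and `d ∈ F ∖ {0}`: for `a ∈ Fˣ`, `{v | locF F d a v ≠ 1}` is finite
  (Hilbert reciprocity ★ `QuadraticForms.hilbertReciprocity_holds` gives finiteness of `{v | (a, d)_v = −1}`, and ★ `mk_quadraticNormSubgroup_ne_one_iff_hilbertSymbol`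
  identifies «class ≠ 1» with «symbol = −1»; the `.mp` half of ★ `exists_prescribed_normClass_sign_iff_even`).  Stated generically so that programme P5's
  rank-2 adapter (F0P5-plan (g2) `F0_P5E3FlatRank2`, F0P5-p02 (g3) FYI 04:14:42Z) CITES it instead of re-proving.
* `imagUnitSq_ne_zero'` — `imagUnitSq L ≠ 0` in `L⁺` (★ `Liu2021.ne_zero_of_coe_eq_mul_self` at ★ `imagUnit_mul_self` ∕ ★ `imagUnit_ne_zero`).
* `stubE3fin_holds` — E3fin: `locF_ne_one_finite L⁺ (imagUnitSq L)`.
* `stubEP_holds` — EP: a collection `ε = epsOf L⁺ d L (2δ)⁻¹ e` with `e ≠ 0` purely imaginary is `locF θ` for `θ := e · 2δ ∈ L⁺`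
  (`c̄(e·2δ) = (−e)(−2δ)`, Mathlib `IsCMField.complexConj_eq_self_iff`; ★ `epsOf_algebraMap_mul` at `(2δ)⁻¹ ≠ 0` — STEP 1 of ★ `isAdmissible_epsOf_iff_even_card`).
`--supports stmt-HodgeConjecture-24833 --as helper`.  HC_CM is proved only modulo the printed citations until rung 0 closes; this file discharges none.

## References
* [Omeara1963] O. T. O'Meara, *Introduction to Quadratic Forms* (1963): §63B Cor. 63:13a, §65A, §71 Thm. 71:18.
* [Liu2021] Y. Liu, Camb. J. Math. 9 (2021) = arXiv:2102.11518: Def. 4.11 (l. 2088), Def. 4.12 (l. 2102–2108).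
-/

set_option autoImplicit false
-- the mandated namespace has the single-problem summit's repeated segment (`HodgeConjecture.HodgeConjecture`)
set_option linter.dupNamespace false

noncomputable section

open NumberField IsDedekindDomain

namespace Summit.HodgeConjecture.HodgeConjecture.Cruxes.H413.F0P2fStubEPE3finGlobalEps

open Literature.NumberTheory Literature.NumberTheory.Automorphic
open Literature.NumberTheory.Automorphic.Liu2021 Literature.NumberTheory.Automorphic.Liu2021.Def411WeilCarriers
open Literature.NumberTheory.GelbartRogawski1991 Literature.NumberTheory.GelbartRogawski1991.UnitaryDualPair
open Literature.NumberTheory.QuadraticForms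

/-! ## §1 The rank-free core: the class family of a global element is trivial almost everywhere -/

/-- **The local norm classes of a GLOBAL `a ∈ Fˣ` w.r.t. `F(√d)∕F` are trivial at almost every finite place** (any number field `F`, any `d ≠ 0`):
`{v | locF F d a v ≠ 1}` is finite.  Hilbert reciprocity (O'Meara 71:18) gives the finiteness of `{v | (a, d)_v = −1}`, and «class `≠ 1` ⟺ symbol `= −1`»
(O'Meara 63:13a ∕ 65A, ★ `mk_quadraticNormSubgroup_ne_one_iff_hilbertSymbol`). [cite: Omeara1963, §71 Thm. 71:18; §63B Cor. 63:13a; §65A] [cite: Liu2021, Def. 4.11 (l. 2088)] -/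
theorem locF_ne_one_finite (F : Type) [Field F] [NumberField F] (d : F) (hd : d ≠ 0) (a : Fˣ) :
    {v : HeightOneSpectrum (𝓞 F) | locF F d a v ≠ 1}.Finite := by
  obtain ⟨hfin, -⟩ := hilbertReciprocity_holds F (a : F) d a.ne_zero hd
  refine hfin.subset fun v hv => ?_
  simp only [Set.mem_setOf_eq] at hv ⊢
  rw [locF_apply, mk_quadraticNormSubgroup_ne_one_iff_hilbertSymbol v hd] at hv
  simpa only [Units.coe_map, RingHom.toMonoidHom_eq_coe, MonoidHom.coe_coe] using hv

/-- `d = imagUnitSq L = δ²` is non-zero in `L⁺` (`δ = imagUnit L ≠ 0`). [cite: Liu2021, §4 preamble (l. 1884)] -/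
theorem imagUnitSq_ne_zero' (L : Type) [Field L] [NumberField L] [IsCMField L] : imagUnitSq L ≠ 0 :=
  ne_zero_of_coe_eq_mul_self (imagUnit_ne_zero L) (imagUnit_mul_self L).symm

/-! ## §2 The two registered stubs -/

/-- **stub E3fin — THE CLASS FAMILY OF A LINE IS TRIVIAL ALMOST EVERYWHERE** (registered body of `F0P2E3ParityRecut.StubE3FinFinite` verbatim):
`locF_ne_one_finite` at `F := L⁺`, `d := imagUnitSq L`. [cite: Omeara1963, §71 Thm. 71:18] [cite: Liu2021, Def. 4.12] -/
theorem stubE3fin_holds :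
    ∀ (L : Type) [Field L] [NumberField L] [IsCMField L] (θ : (↥(maximalRealSubfield L))ˣ),
      {v : HeightOneSpectrum (𝓞 ↥(maximalRealSubfield L)) | locF (↥(maximalRealSubfield L)) (imagUnitSq L) θ v ≠ 1}.Finite :=
  fun L _ _ _ θ => locF_ne_one_finite (↥(maximalRealSubfield L)) (imagUnitSq L) (imagUnitSq_ne_zero' L) θ

/-- **stub EP — A GLOBAL COLLECTION IS THE CLASS FAMILY OF A LINE** (registered body of `F0P2E3ParityRecut.StubEPGlobalEpsIsLine` verbatim): if
`ε = epsOf L⁺ (imagUnitSq L) L (2δ)⁻¹ e` with `e ≠ 0`, `ē = −e`, then `ε = locF θ` with `θ := e · 2δ ∈ (L⁺)ˣ` (STEP 1 of ★ `isAdmissible_epsOf_iff_even_card`,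
★ `epsOf_algebraMap_mul`). [cite: Liu2021, Def. 4.12 (l. 2102–2108)] -/
theorem stubEP_holds :
    ∀ (L : Type) [Field L] [NumberField L] [IsCMField L] (ε : Eps (↥(maximalRealSubfield L)) (imagUnitSq L)),
      (∃ e : L, e ≠ 0 ∧ IsCMField.complexConj L e = -e ∧
          epsOf (↥(maximalRealSubfield L)) (imagUnitSq L) L (2 * imagUnit L)⁻¹ e = ε) →
        ∃ θ : (↥(maximalRealSubfield L))ˣ, locF (↥(maximalRealSubfield L)) (imagUnitSq L) θ = ε := by
  intro L _ _ _ ε he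
  obtain ⟨e, he0, hec, hε⟩ := he
  have hδ : IsCMField.complexConj L (2 * imagUnit L)⁻¹ = -(2 * imagUnit L)⁻¹ := by
    rw [map_inv₀, map_mul, map_ofNat, complexConj_imagUnit, mul_neg, inv_neg]
  have hδ0 : (2 * imagUnit L)⁻¹ ≠ 0 := inv_ne_zero (mul_ne_zero two_ne_zero (imagUnit_ne_zero L))
  -- `θ := e · ((2δ)⁻¹)⁻¹ = e · 2δ` lies in `L⁺`
  have hmemF : e * ((2 * imagUnit L)⁻¹)⁻¹ ∈ maximalRealSubfield L := by
    rw [← IsCMField.complexConj_eq_self_iff, map_mul, map_inv₀, hδ, hec, inv_neg, neg_mul_neg]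
  have hθ0 : (⟨e * ((2 * imagUnit L)⁻¹)⁻¹, hmemF⟩ : ↥(maximalRealSubfield L)) ≠ 0 := by
    intro h
    have : e * ((2 * imagUnit L)⁻¹)⁻¹ = 0 := congrArg Subtype.val h
    exact mul_ne_zero he0 (inv_ne_zero hδ0) this
  refine ⟨Units.mk0 _ hθ0, ?_⟩
  rw [← hε, ← epsOf_algebraMap_mul (↥(maximalRealSubfield L)) (imagUnitSq L) L (2 * imagUnit L)⁻¹ hδ0]
  congr 1
  change e * ((2 * imagUnit L)⁻¹)⁻¹ * (2 * imagUnit L)⁻¹ = e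
  rw [inv_mul_cancel_right₀ hδ0]

end Summit.HodgeConjecture.HodgeConjecture.Cruxes.H413.F0P2fStubEPE3finGlobalEps
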